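import Summits.CriticalPhenomena.PercolationContinuityZ3.Theorems.Transplant.RationalHalfSlabDesign
import HarnessLib

/-!
# The station move with a FAR station: the arm is constrained only beyond the station's abscissa (link lemma for tilted sector-slabs)

builds on p205010 (kernel theorem, internal audit signed; external expert review pending) — NOT used in this file.
Lane `prim-bschramm`, seat `prim-bschramm-p2` (gen 24; class C1b, METHOD = input substitution; memo `HOME/bschramm/P2-LATTICES.md` §86);
helper file (`--supports stmt-CriticalPhenomena-4575 --as helper`).

THE POINT.  Aizenman–Chayes–Chayes–Fröhlich–Russo's station move as typed in the tree (`ConeSlabUniq.link_move_region`,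
`RationalHalfSlab.move_apex_cyl_region`) asks the WHOLE steep region `S` of the apex `b` to lie in the horizontal strip `{w₂ ≤ x₂ ≤ Z}` of the
station `w`.  In the slab cut by a planar sector strictly inside a quadrant (`{s₁x₁ ≤ x₂ ≤ s₂x₁}`, `s₁ > 0`) the lower edge rises, the station sits
far to the right (`w₁ = Y ≫ N`) at height `≈ s₁Y`, and the arms start near the box at heights `≈ s₁N` — below the strip.  Only the part of the
arm BEYOND the station's abscissa matters for the crossing: if every point of `S` with `x₁ ≥ w₁` lies in the strip, the portion of the arm's
walk after its last visit to `{x₁ = w₁}` (first passage of the reversed walk, `exists_prefix_neg_apply_eq`) crosses the rectangle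
`[w₁, T] × [w₂, Z]` from left to right, the station's shallow walk crosses it from bottom to top, and `exists_common_shadow₂_of_crossing` +
the fibre junction (`≤ k` vertical edges) conclude exactly as before:
* **`link_move_region_far`** (any step graph `K` containing the steps inside `S`, inside the shallow region and the fibre segments);
* **`move_apex_cyl_far`** (the cylindrical-domain packaging of `move_apex_cyl_region` with the weakened strip hypothesis).
USE (memo §86): the station design for tilted sector-slabs (`TiltedSectorDesign`).
[cite: AizenmanChayesChayesFrohlichRusso1983, §4 Lemma 4.3, Lemma 4.2 (a)] [cite: GrimmettPercolation1999, §8.3 Thm (8.8) p. 202]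
-/

noncomputable section

namespace Summit.CriticalPhenomena.PercolationContinuityZ3.Theorems.Transplant

namespace TiltSector

open MeasureTheory Literature.Probability.Percolation Literature.Probability.LatticeModels SimpleGraph HSU OrthantUniq HalfSlabUniq

variable {k N : ℕ} {D : Set (Site 3)}

/-- **Crossing and junction with a far station.**  Let `S ⊆ S_k` contain the apex `b`, lie below `{x₁ ≤ T}`, and satisfy the strip condition
`w₂ ≤ x₂ ≤ Z` ONLY at its points with `x₁ ≥ w₁`; let the port `w ∈ S_k` have `w₂ ≤ Z`, `b₁ ≤ w₁`, and a truncated shallow region below `{x₁ ≤ T}`.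
On the event "`b` reaches `{x₁ = T}` inside `S` and `w` reaches `{x₂ = Z}` inside its shallow region", for any step graph `K` containing the steps
inside `S`, inside the shallow region and inside the fibre segments, at most `k` extra open edges of `[-M,M]³` join `b` to `w` through open `K`-steps.
[cite: AizenmanChayesChayesFrohlichRusso1983, §4 Lemma 4.3, Lemma 4.2 (a)] -/
theorem link_move_region_far {S : Set (Site 3)} {b w : Site 3} {T Z : ℤ} (hS : S ⊆ slab 3 k) (hbS : b ∈ S)
    (hSy : ∀ x ∈ S, x 1 ≤ T) (hSz : ∀ x ∈ S, w 1 ≤ x 1 → w 2 ≤ x 2 ∧ x 2 ≤ Z) (hw : w ∈ slab 3 k) (hwZ : w 2 ≤ Z) (hbw : b 1 ≤ w 1)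
    (hQy : ∀ x ∈ shallowReg k w Z, x 1 ≤ T) {K : SimpleGraph (Site 3)} (hKS : withinGraph (zdGraph 3) S ≤ K)
    (hKH : withinGraph (zdGraph 3) (shallowReg k w Z) ≤ K)
    (hKJ : ∀ s ∈ S, ∀ t ∈ shallowReg k w Z, s 1 = t 1 → s 2 = t 2 →
      withinGraph (zdGraph 3) {z | ∀ j, min (s j) (t j) ≤ z j ∧ z j ≤ max (s j) (t j)} ≤ K)
    {M : ℕ} (hM : ∀ x ∈ S ∪ shallowReg k w Z, ∀ j, |x j| ≤ M) {ω : BondConfig (Site 3)}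
    (hω : ω ∈ reachEvent (withinGraph (zdGraph 3) S) b {x | x 1 = T} ∩ reachEvent (withinGraph (zdGraph 3) (shallowReg k w Z)) w {x | x 2 = Z}) :
    ∃ F : Finset (Sym2 (Site 3)), F ⊆ edgesIn (zdGraph 3) (box 3 M) ∧ F.card ≤ k ∧ ω ∪ ↑F ∈ openConnVia K b w := by
  obtain ⟨⟨e, he, hSr⟩, ⟨f, hf, hH⟩⟩ := hω
  simp only [Set.mem_setOf_eq] at he hf
  obtain ⟨P₀⟩ := mem_openConnVia_iff.1 hSr
  obtain ⟨Q₀⟩ := mem_openConnVia_iff.1 hH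
  have hw_mem : w ∈ shallowReg k w Z := port_mem_shallowReg hw hwZ
  have hPsupp : ∀ z ∈ P₀.support, z ∈ S := support_subset_of_walk_within P₀ hbS
  have hQsupp : ∀ z ∈ Q₀.support, z ∈ shallowReg k w Z := support_subset_of_walk_within Q₀ hw_mem
  let P := P₀.mapLe (openGraph_inf_withinGraph_le ω _)
  let Q := Q₀.mapLe (openGraph_inf_withinGraph_le ω _)
  have hQbd : ∀ z ∈ Q.support, w 2 ≤ z 2 ∧ z 2 ≤ Z ∧ w 1 ≤ z 1 ∧ z 1 ≤ T := by
    intro z hz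
    rw [Walk.support_mapLe_eq_support] at hz
    obtain ⟨-, h1, -, h3, h4⟩ := shallowReg_props (hQsupp z hz)
    exact ⟨h3, h4, h1, hQy z (hQsupp z hz)⟩
  -- the portion of the arm after its last visit to `{x₁ = w₁}`: first passage of the reversed walk down to the level `w₁`
  have hwT : w 1 ≤ T := hQy w hw_mem
  have heT : w 1 ≤ e 1 := by rw [he]; exact hwT
  obtain ⟨e', W, he', hW⟩ := exists_prefix_neg_apply_eq (le_refl (zdGraph 3)) 1 P.reverse heT hbw
  have hWsupp : ∀ z ∈ W.support, z ∈ P₀.support ∧ w 1 ≤ z 1 := by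
    intro z hz
    obtain ⟨hzP, hz1⟩ := hW z hz
    rw [Walk.support_reverse, List.mem_reverse, Walk.support_mapLe_eq_support] at hzP
    exact ⟨hzP, hz1⟩
  have hPbd : ∀ z ∈ W.reverse.support, w 2 ≤ z 2 ∧ z 2 ≤ Z ∧ w 1 ≤ z 1 ∧ z 1 ≤ T := by
    intro z hz
    rw [Walk.support_reverse, List.mem_reverse] at hz
    obtain ⟨hzP, hz1⟩ := hWsupp z hz
    have hzS := hPsupp z hzP
    exact ⟨(hSz z hzS hz1).1, (hSz z hzS hz1).2, hz1, hSy z hzS⟩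
  obtain ⟨t, ht, s, hs, h2, h1⟩ := exists_common_shadow₂_of_crossing (i := (2 : Fin 3)) (j := 1) (by decide) Q W.reverse hQbd hPbd
    rfl hf he' he
  rw [Walk.support_mapLe_eq_support] at ht
  rw [Walk.support_reverse, List.mem_reverse] at hs
  have hsP : s ∈ P₀.support := (hWsupp s hs).1
  have hsS : s ∈ S := hPsupp s hsP
  have htH : t ∈ shallowReg k w Z := hQsupp t ht
  obtain ⟨F, hFc, hFs, hFr⟩ := exists_junction s t
  have hdist : l1dist s t ≤ k := l1dist_le_of_fibre (hS hsS) (shallowReg_props htH).1 h1.symm h2.symm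
  refine ⟨F, ?_, hFc.trans hdist, ?_⟩
  · intro e'' he''
    exact edgeSet_withinGraph_subset_edgesIn (bbox_subset_boxSet (hM s (Or.inl hsS)) (hM t (Or.inr htH))) (hFs (Finset.mem_coe.2 he''))
  · refine mem_openConnVia_iff.2 ?_
    have r1 : (openGraph (ω ∪ ↑F) ⊓ K).Reachable b s := reachable_of_arm (reachable_of_mem_support' P₀ s hsP) hKS
    have r2 : (openGraph (ω ∪ ↑F) ⊓ K).Reachable s t := reachable_of_junction hFr (subset_refl F) (hKJ s hsS t htH h1.symm h2.symm)
    have r3 : (openGraph (ω ∪ ↑F) ⊓ K).Reachable t w := (reachable_of_arm (reachable_of_mem_support' Q₀ t ht) hKH).symm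
    exact r1.trans (r2.trans r3)

/-- **The far-station move in a cylindrical slab domain.**  Let `D ⊆ S_k` be cylindrical, `Ω ∈ S_k` a station whose truncated shallow region
`shallowReg k Ω Z` lies in `D` off the box `[-N,N]³` and below `{x₁ ≤ T}`, and `S ⊆ S_k` a region containing the apex `b` (`b₁ ≤ Ω₁`), lying in `D`
off the box and below `{x₁ ≤ T}`, whose points BEYOND the station's abscissa (`x₁ ≥ Ω₁`) lie in the strip `{Ω₂ ≤ x₂ ≤ Z}`; both regions inside
`[-M,M]³`.  On the event "`b` reaches `{x₁ = T}` inside `S` and `Ω` reaches `{x₂ = Z}` inside its shallow region" at most `k` extra open edges of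
`[-M,M]³` join `b` to `Ω` through open exterior steps of `D`. [cite: AizenmanChayesChayesFrohlichRusso1983, §4 Lemma 4.3, Lemma 4.2 (a)] -/
theorem move_apex_cyl_far (hkN : k ≤ N) (hcyl : ∀ x ∈ D, ∀ y ∈ slab 3 k, y 1 = x 1 → y 2 = x 2 → y ∈ D)
    {S : Set (Site 3)} {b Ω : Site 3} {T Z : ℤ} (hSslab : S ⊆ slab 3 k) (hbS : b ∈ S) (hΩ : Ω ∈ slab 3 k) (hΩZ : Ω 2 ≤ Z)
    (hbΩ : b 1 ≤ Ω 1)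
    (hS : ∀ x ∈ S, x ∈ D ∧ x ∉ boxSet 3 N ∧ x 1 ≤ T ∧ (Ω 1 ≤ x 1 → Ω 2 ≤ x 2 ∧ x 2 ≤ Z))
    (hH : ∀ x ∈ shallowReg k Ω Z, x ∈ D ∧ x ∉ boxSet 3 N ∧ x 1 ≤ T)
    {M : ℕ} (hM : ∀ x ∈ S ∪ shallowReg k Ω Z, ∀ j, |x j| ≤ M)
    {ω : BondConfig (Site 3)}
    (hω : ω ∈ reachEvent (withinGraph (zdGraph 3) S) b {x | x 1 = T} ∩ reachEvent (withinGraph (zdGraph 3) (shallowReg k Ω Z)) Ω {x | x 2 = Z}) :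
    ∃ F : Finset (Sym2 (Site 3)), F ⊆ edgesIn (zdGraph 3) (box 3 M) ∧ F.card ≤ k ∧
      ω ∪ ↑F ∈ openConnVia (starGraph (withinGraph (zdGraph 3) D) Set.univ (boxSet 3 N)) b Ω := by
  refine link_move_region_far hSslab hbS (fun x hx => (hS x hx).2.2.1) (fun x hx => (hS x hx).2.2.2) hΩ hΩZ hbΩ
    (fun x hx => (hH x hx).2.2) (withinGraph_le_dext fun x hx => ⟨(hS x hx).1, (hS x hx).2.1⟩)
    (withinGraph_le_dext fun x hx => ⟨(hH x hx).1, (hH x hx).2.1⟩) (fun s hs t ht h1 h2 => withinGraph_le_dext fun z hz => ?_) hM hω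
  -- fibre segment between `s` and `t`: in `D` by cylindricity (same `(x₁, x₂)` as `t`), off the box as `t`
  have hs0 := hSslab hs
  have ht0 := (shallowReg_props ht).1
  have hz1 : z 1 = s 1 := eq_of_mem_bbox hz h1
  have hz2 : z 2 = s 2 := eq_of_mem_bbox hz h2
  have hz0 := hz 0
  have hzslab : z ∈ slab 3 k := ⟨le_trans (le_min hs0.1 ht0.1) hz0.1, le_trans hz0.2 (max_le hs0.2 ht0.2)⟩
  have hzD : z ∈ D := hcyl t (hH t ht).1 z hzslab (by rw [hz1, h1]) (by rw [hz2, h2])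
  refine ⟨hzD, fun hzbox => (hH t ht).2.1 ?_⟩
  rw [mem_boxSet_iff] at hzbox ⊢
  intro j
  fin_cases j
  · show -(N : ℤ) ≤ t 0 ∧ t 0 ≤ N
    exact ⟨by have := ht0.1; omega, by have := ht0.2; omega⟩
  · show -(N : ℤ) ≤ t 1 ∧ t 1 ≤ N
    have := hzbox 1; rw [hz1, h1] at this; exact this
  · show -(N : ℤ) ≤ t 2 ∧ t 2 ≤ N
    have := hzbox 2; rw [hz2, h2] at this; exact this

end TiltSector

end Summit.CriticalPhenomena.PercolationContinuityZ3.Theorems.Transplant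

end
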